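import Mathlib.Analysis.Convex.Segment
import Mathlib.Analysis.Convex.Topology
import Mathlib.Analysis.Normed.Module.Basic
import Mathlib.Topology.EMetricSpace.Lipschitz
import Mathlib.Topology.Order.Compact
import HarnessLib

/-!
# Piecewise Lipschitz maps on convex sets are Lipschitz

A continuity-plus-pieces principle used in every perturbation argument for piecewise smooth
(PD) and piecewise linear maps (e.g. Munkres, *Elementary differential topology* (1966), §8,
proofs of 8.7–8.8; Hirsch–Mazur (1974), Part I, §5): if a convex set `S` of a real normed space
is covered by finitely many **closed convex** pieces and a map `f`, continuous on `S`, is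
`K`-Lipschitz on each piece (intersected with `S`), then `f` is `K`-Lipschitz on `S`.  The
segment between two points of `S` is cut by the pieces into finitely many closed intervals, and
the one-dimensional statement (`norm_sub_le_mul_of_pieces`) is proved by induction on the number
of pieces: follow the piece containing the left end point as far as it goes, then recurse on the
remaining pieces, which cover the rest of the interval by closedness.  Without convexity of the
pieces, or without continuity of `f`, the statement fails.

* `norm_sub_le_mul_of_pieces` — the one-dimensional statement on `[a, b]`;
* `lipschitzOnWith_of_convex_pieces` — the statement in a real normed space.

Everything here is proved; no definitions and no named facts are introduced. [folklore]
-/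

open Set Function Filter Metric
open scoped Topology NNReal

namespace Literature.Analysis.Convexity

section OneDim

variable {F : Type*} [NormedAddCommGroup F]

/-- **Piecewise Lipschitz along an interval.** Let `[a, b]` be covered by finitely many closed
convex subsets `J i` of `ℝ` (`i ∈ s`), and let `g` be continuous on `[a, b]` with
`‖g x - g y‖ ≤ C |x - y|` whenever `x, y ∈ [a, b]` lie in a common piece. Then
`‖g b - g a‖ ≤ C (b - a)`. Induction on the number of pieces: the piece containing `a` contains
`[a, r]`, `r` its last point in `[a, b]`, and `[r, b]` is covered by the other pieces.
[folklore] -/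
theorem norm_sub_le_mul_of_pieces {ι : Type*} (s : Finset ι) {J : ι → Set ℝ}
    (hJc : ∀ i ∈ s, IsClosed (J i)) (hJv : ∀ i ∈ s, Convex ℝ (J i)) {g : ℝ → F} {a b C : ℝ}
    (hab : a ≤ b) (hcover : Icc a b ⊆ ⋃ i ∈ s, J i) (hg : ContinuousOn g (Icc a b))
    (hlip : ∀ i ∈ s, ∀ x ∈ Icc a b ∩ J i, ∀ y ∈ Icc a b ∩ J i, ‖g x - g y‖ ≤ C * |x - y|) :
    ‖g b - g a‖ ≤ C * (b - a) := by
  classical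
  induction s using Finset.strongInduction generalizing a with
  | H s ih =>
    rcases hab.eq_or_lt with rfl | hab'
    · simp
    -- the piece containing `a` and its last point `r` in `[a, b]`
    obtain ⟨i, hi, hai⟩ : ∃ i ∈ s, a ∈ J i := by
      simpa only [mem_iUnion, exists_prop] using hcover (left_mem_Icc.2 hab)
    set T : Set ℝ := Icc a b ∩ J i with hT
    have hTc : IsClosed T := isClosed_Icc.inter (hJc i hi)
    have hTne : T.Nonempty := ⟨a, left_mem_Icc.2 hab, hai⟩
    have hTbdd : BddAbove T := ⟨b, fun x hx => hx.1.2⟩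
    set r : ℝ := sSup T with hr
    have hrT : r ∈ T := hTc.csSup_mem hTne hTbdd
    have har : a ≤ r := le_csSup hTbdd ⟨left_mem_Icc.2 hab, hai⟩
    have hrb : r ≤ b := hrT.1.2
    -- `[a, r] ⊆ J i`, so the first stretch is controlled
    have h1 : ‖g r - g a‖ ≤ C * (r - a) := by
      have h := hlip i hi r hrT a ⟨left_mem_Icc.2 hab, hai⟩
      rwa [abs_of_nonneg (sub_nonneg.2 har)] at h
    rcases hrb.eq_or_lt with hrb' | hrb'
    · rw [hrb'] at h1; exact h1
    -- the remaining pieces cover `[r, b]`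
    have hcover' : Icc r b ⊆ ⋃ j ∈ s.erase i, J j := by
      have hIoc : Ioc r b ⊆ ⋃ j ∈ s.erase i, J j := by
        intro x hx
        have hxab : x ∈ Icc a b := ⟨har.trans hx.1.le, hx.2⟩
        obtain ⟨j, hj, hxj⟩ : ∃ j ∈ s, x ∈ J j := by
          simpa only [mem_iUnion, exists_prop] using hcover hxab
        have hji : j ≠ i := by
          rintro rfl
          have : x ≤ r := le_csSup hTbdd ⟨hxab, hxj⟩
          exact absurd hx.1 (not_lt.2 this)
        exact mem_iUnion₂.2 ⟨j, Finset.mem_erase.2 ⟨hji, hj⟩, hxj⟩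
      have hcl : IsClosed (⋃ j ∈ s.erase i, J j) :=
        isClosed_biUnion_finset fun j hj => hJc j (Finset.mem_of_mem_erase hj)
      have h := closure_minimal hIoc hcl
      rwa [closure_Ioc hrb'.ne] at h
    have h2 : ‖g b - g r‖ ≤ C * (b - r) :=
      ih (s.erase i) (Finset.erase_ssubset hi) (fun j hj => hJc j (Finset.mem_of_mem_erase hj))
        (fun j hj => hJv j (Finset.mem_of_mem_erase hj)) hrb hcover'
        (hg.mono (Icc_subset_Icc_left har))
        (fun j hj x hx y hy => hlip j (Finset.mem_of_mem_erase hj) x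
          ⟨Icc_subset_Icc_left har hx.1, hx.2⟩ y ⟨Icc_subset_Icc_left har hy.1, hy.2⟩)
    calc ‖g b - g a‖ = ‖(g b - g r) + (g r - g a)‖ := by rw [sub_add_sub_cancel]
      _ ≤ ‖g b - g r‖ + ‖g r - g a‖ := norm_add_le _ _
      _ ≤ C * (b - r) + C * (r - a) := add_le_add h2 h1
      _ = C * (b - a) := by ring

end OneDim

section Normed

variable {E F : Type*} [NormedAddCommGroup E] [NormedSpace ℝ E] [NormedAddCommGroup F]

/-- **Piecewise Lipschitz maps on convex sets are Lipschitz.** Let the convex set `S` be covered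
by finitely many closed convex sets `Q i` (`i ∈ s`) and let `f` be continuous on `S` and
`K`-Lipschitz on each `S ∩ Q i`. Then `f` is `K`-Lipschitz on `S` (apply
`norm_sub_le_mul_of_pieces` along the segment between two points, cut by the preimages of the
pieces). [folklore] -/
theorem lipschitzOnWith_of_convex_pieces {ι : Type*} (s : Finset ι) {Q : ι → Set E}
    (hQc : ∀ i ∈ s, IsClosed (Q i)) (hQv : ∀ i ∈ s, Convex ℝ (Q i)) {S : Set E} (hS : Convex ℝ S)
    (hcover : S ⊆ ⋃ i ∈ s, Q i) {f : E → F} (hf : ContinuousOn f S) {K : ℝ≥0}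
    (hlip : ∀ i ∈ s, LipschitzOnWith K f (S ∩ Q i)) : LipschitzOnWith K f S := by
  refine LipschitzOnWith.of_dist_le_mul fun x hx y hy => ?_
  -- the segment `γ θ = x + θ • (y - x)`
  set γ : ℝ → E := fun θ => x + θ • (y - x) with hγ
  have hγc : Continuous γ := by fun_prop
  have hγS : ∀ θ ∈ Icc (0 : ℝ) 1, γ θ ∈ S := fun θ hθ => hS.add_smul_sub_mem hx hy hθ
  have hγ0 : γ 0 = x := by simp [hγ]
  have hγ1 : γ 1 = y := by simp [hγ]
  have hdist : ∀ θ θ' : ℝ, dist (γ θ) (γ θ') = |θ - θ'| * ‖y - x‖ := fun θ θ' => by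
    rw [dist_eq_norm, hγ]
    simp only [add_sub_add_left_eq_sub, ← sub_smul, norm_smul, Real.norm_eq_abs]
  have h := norm_sub_le_mul_of_pieces s (J := fun i => γ ⁻¹' Q i)
    (fun i hi => (hQc i hi).preimage hγc)
    (fun i hi => ?_) (g := f ∘ γ) (C := K * ‖y - x‖) zero_le_one ?_ ?_ ?_
  · rw [comp_apply, comp_apply, hγ1, hγ0, sub_zero, mul_one] at h
    rw [dist_eq_norm, dist_comm, dist_eq_norm, norm_sub_rev]
    exact h
  · -- preimages of convex sets under the affine map `γ` are convex
    intro θ hθ θ' hθ' p q hp hq hpq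
    show γ (p • θ + q • θ') ∈ Q i
    have : γ (p • θ + q • θ') = p • γ θ + q • γ θ' := by
      simp only [hγ, smul_eq_mul]
      have h1 : x = p • x + q • x := by rw [← add_smul, hpq, one_smul]
      calc x + (p * θ + q * θ') • (y - x) = (p • x + q • x) + (p * θ + q * θ') • (y - x) := by
            rw [← h1]
        _ = p • (x + θ • (y - x)) + q • (x + θ' • (y - x)) := by module
    rw [this]
    exact hQv i hi hθ hθ' hp hq hpq
  · intro θ hθ
    have := hcover (hγS θ hθ)
    simpa only [mem_iUnion, mem_preimage, exists_prop] using this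
  · exact hf.comp hγc.continuousOn fun θ hθ => hγS θ hθ
  · intro i hi θ hθ θ' hθ'
    have h := (hlip i hi).dist_le_mul (γ θ) ⟨hγS θ hθ.1, hθ.2⟩ (γ θ') ⟨hγS θ' hθ'.1, hθ'.2⟩
    rw [hdist, dist_eq_norm] at h
    calc ‖(f ∘ γ) θ - (f ∘ γ) θ'‖ ≤ K * (|θ - θ'| * ‖y - x‖) := h
      _ = K * ‖y - x‖ * |θ - θ'| := by ring

end Normed

end Literature.Analysis.Convexity
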